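import Summits.AtomisticToContinuum.BoseEinsteinCondensation.Theorems.SoloBlindTwistZeroFree

/-!
# SoloBlind — Gaussian decay of the twisted Villain / rotor weight in the REAL twist, at every tilt

Solo-blind `AtomisticToContinuum / BoseEinsteinCondensation`, census line N16 (C3 typed), interpolation
lemma (`HOME/work/frustrated_fs/interpolation.md`, s21), hypothesis (H2) = clause (Z_far), model case; claim C143.

K14 (`SoloBlindTwistZeroFree`) showed that the twisted Villain sum
`S(φ) = Σ_{k∈ℤ} exp(−(φ+2πk)²/(2t) + iν(φ+2πk))` has no zeros for `|φ| ≤ π − δ`, `q := exp(−2πδ/t) < 1/3`,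
at every filling `ν` (= every imaginary twist / tilt). Here we make the domination QUANTITATIVE and two-sided:
  `exp(−φ²/2t)·(1 − 3q) ≤ ‖S(φ)‖·(1 − q) ≤ exp(−φ²/2t)·(1 + q)`       (`villainTwisted_tsum_norm_bounds`),
uniformly in `ν`, from the general two-sided geometric-tail lemma `int_tsum_sub_zero_norm_le`
(`‖Σ_ℤ T − T 0‖ ≤ 2Aq/(1−q)` whenever `‖T k‖ ≤ A q^{|k|}`). Consequently the twisted weight is
GAUSSIAN-SMALL in the real twist relative to the untwisted weight AT THE SAME TILT:
  `‖rotorWeight t ν φ‖ · (1 − 3q) ≤ exp(−φ²/(2t)) · (1 + q) · ‖rotorWeight t ν 0‖`   (`rotorWeight_norm_gaussian_decay`),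
for every real `ν` — the model case of hypothesis (H2) ("far region": a macroscopic real twist costs
`e^{−βφ²/2}`, `β = 1/t`, at every tilt) of the interpolation lemma that turns twisted-amplitude control into a
Fröhlich–Spencer-admissible analytic interpolant (CMP 81 (1981) Condition (4.10), App. B), and of clause
(Z_far) of the continuum blocking conjecture. Zero-freeness (K14) alone does not give it: a weight supported
on even currents is zero-free near the axis and violates it at `φ = π`.
No axioms beyond Mathlib; sorry-free.
-/

open Complex

namespace Summit.AtomisticToContinuum.BoseEinsteinCondensation.Theorems

/-- **Two-sided geometric tails.** If `‖T k‖ ≤ A·q^{|k|}` for all `k : ℤ` with `0 ≤ q < 1`, then `T` is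
summable over `ℤ` and `‖Σ_k T k − T 0‖ ≤ 2·A·q/(1−q)`. -/
theorem int_tsum_sub_zero_norm_le {T : ℤ → ℂ} {A q : ℝ} (hq0 : 0 ≤ q) (hq1 : q < 1)
    (hbound : ∀ k : ℤ, ‖T k‖ ≤ A * q ^ k.natAbs) :
    Summable T ∧ ‖∑' k : ℤ, T k - T 0‖ ≤ 2 * (A * (q / (1 - q))) := by
  have hgeo : HasSum (fun n : ℕ => A * q ^ (n + 1)) (A * (q / (1 - q))) := by
    have h1 : HasSum (fun n : ℕ => q ^ n) (1 - q)⁻¹ := hasSum_geometric_of_lt_one hq0 hq1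
    have h2 : HasSum (fun n : ℕ => (A * q) * q ^ n) ((A * q) * (1 - q)⁻¹) := h1.mul_left (A * q)
    have hfun : (fun n : ℕ => A * q ^ (n + 1)) = (fun n : ℕ => (A * q) * q ^ n) := by
      funext n; ring
    have hval : A * (q / (1 - q)) = (A * q) * (1 - q)⁻¹ := by rw [div_eq_mul_inv]; ring
    rw [hfun, hval]; exact h2
  have hpos : ∀ n : ℕ, ‖T ((n : ℤ) + 1)‖ ≤ A * q ^ (n + 1) := fun n => by
    have := hbound ((n : ℤ) + 1)
    have hn : ((n : ℤ) + 1).natAbs = n + 1 := by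
      have : ((n : ℤ) + 1) = ((n + 1 : ℕ) : ℤ) := by push_cast; ring
      rw [this, Int.natAbs_natCast]
    rwa [hn] at this
  have hneg : ∀ n : ℕ, ‖T (-((n : ℤ) + 1))‖ ≤ A * q ^ (n + 1) := fun n => by
    have := hbound (-((n : ℤ) + 1))
    have hn : (-((n : ℤ) + 1)).natAbs = n + 1 := by
      rw [Int.natAbs_neg]
      have : ((n : ℤ) + 1) = ((n + 1 : ℕ) : ℤ) := by push_cast; ring
      rw [this, Int.natAbs_natCast]
    rwa [hn] at this
  have hsumP : Summable (fun n : ℕ => T ((n : ℤ) + 1)) :=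
    Summable.of_norm_bounded hgeo.summable hpos
  have hsumN : Summable (fun n : ℕ => T (-((n : ℤ) + 1))) :=
    Summable.of_norm_bounded hgeo.summable hneg
  have hnormP : ‖∑' n : ℕ, T ((n : ℤ) + 1)‖ ≤ A * (q / (1 - q)) := tsum_of_norm_bounded hgeo hpos
  have hnormN : ‖∑' n : ℕ, T (-((n : ℤ) + 1))‖ ≤ A * (q / (1 - q)) := tsum_of_norm_bounded hgeo hneg
  -- assemble the ℤ-indexed sum: Σ_ℤ T = T 0 + Σ_{n≥0} T(n+1) + Σ_{n≥0} T(-(n+1))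
  have hnat : HasSum (fun n : ℕ => T (n : ℤ)) (T 0 + ∑' n : ℕ, T ((n : ℤ) + 1)) := by
    have hfun : (fun n : ℕ => T (((n + 1 : ℕ) : ℤ))) = (fun n : ℕ => T ((n : ℤ) + 1)) := by
      funext n
      simp only [Nat.cast_add, Nat.cast_one]
    have h'' : HasSum (fun n : ℕ => (fun m : ℕ => T (m : ℤ)) (n + 1)) (∑' n : ℕ, T ((n : ℤ) + 1)) := by
      show HasSum (fun n : ℕ => T (((n + 1 : ℕ) : ℤ))) _
      rw [hfun]
      exact hsumP.hasSum
    have h3 := (hasSum_nat_add_iff (f := fun m : ℕ => T (m : ℤ)) 1).mp h''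
    simpa [Finset.sum_range_one, add_comm] using h3
  have hint : HasSum T (T 0 + ∑' n : ℕ, T ((n : ℤ) + 1) + ∑' n : ℕ, T (-((n : ℤ) + 1))) :=
    HasSum.of_nat_of_neg_add_one hnat hsumN.hasSum
  refine ⟨hint.summable, ?_⟩
  rw [hint.tsum_eq]
  have hrw : T 0 + ∑' n : ℕ, T ((n : ℤ) + 1) + ∑' n : ℕ, T (-((n : ℤ) + 1)) - T 0
      = ∑' n : ℕ, T ((n : ℤ) + 1) + ∑' n : ℕ, T (-((n : ℤ) + 1)) := by ring
  rw [hrw]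
  calc ‖∑' n : ℕ, T ((n : ℤ) + 1) + ∑' n : ℕ, T (-((n : ℤ) + 1))‖
      ≤ ‖∑' n : ℕ, T ((n : ℤ) + 1)‖ + ‖∑' n : ℕ, T (-((n : ℤ) + 1))‖ := norm_add_le _ _
    _ ≤ 2 * (A * (q / (1 - q))) := by linarith

/-- **K15 (two-sided Gaussian bounds, every tilt).** For `t > 0`, `0 ≤ δ ≤ π`, `|φ| ≤ π − δ`,
`q = exp(−2πδ/t) < 1` and every real `ν`:
`exp(−φ²/(2t))·(1 − 3q) ≤ ‖Σ_k villainTwistedTerm t ν φ k‖·(1 − q) ≤ exp(−φ²/(2t))·(1 + q)`. -/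
theorem villainTwisted_tsum_norm_bounds {t δ φ q : ℝ} (ht : 0 < t) (hδ : 0 ≤ δ) (hδπ : δ ≤ Real.pi)
    (hφ : |φ| ≤ Real.pi - δ) (hqdef : q = Real.exp (-(2 * Real.pi * δ / t))) (hq1 : q < 1) (ν : ℝ) :
    Real.exp (-φ ^ 2 / (2 * t)) * (1 - 3 * q) ≤ ‖∑' k : ℤ, villainTwistedTerm t ν φ k‖ * (1 - q) ∧
    ‖∑' k : ℤ, villainTwistedTerm t ν φ k‖ * (1 - q) ≤ Real.exp (-φ ^ 2 / (2 * t)) * (1 + q) := by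
  set T : ℤ → ℂ := villainTwistedTerm t ν φ with hT
  set A : ℝ := Real.exp (-φ ^ 2 / (2 * t)) with hA
  have hq0 : 0 ≤ q := by rw [hqdef]; exact (Real.exp_pos _).le
  have h1q : 0 < 1 - q := by linarith
  have hA0 : 0 < A := Real.exp_pos _
  have hT0 : ‖T 0‖ = A := by
    rw [hT, norm_villainTwistedTerm]
    simp [hA]
  have hbound : ∀ k : ℤ, ‖T k‖ ≤ A * q ^ k.natAbs := fun k => by
    rw [hqdef]
    exact norm_villainTwistedTerm_le ht hδ hδπ hφ ν k
  obtain ⟨_, hB⟩ := int_tsum_sub_zero_norm_le hq0 hq1 hbound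
  set S : ℂ := ∑' k : ℤ, T k with hS
  -- ‖S − T 0‖·(1 − q) ≤ 2 A q
  have hBq : ‖S - T 0‖ * (1 - q) ≤ 2 * A * q := by
    have h := mul_le_mul_of_nonneg_right hB h1q.le
    have hval : 2 * (A * (q / (1 - q))) * (1 - q) = 2 * A * q := by
      field_simp
    linarith [hval]
  have hup : ‖S‖ - ‖T 0‖ ≤ ‖S - T 0‖ := norm_sub_norm_le S (T 0)
  have hlow : ‖T 0‖ - ‖S‖ ≤ ‖S - T 0‖ := by
    rw [← norm_sub_rev]; exact norm_sub_norm_le (T 0) S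
  rw [hT0] at hup hlow
  have hSn : 0 ≤ ‖S‖ := norm_nonneg _
  constructor
  · nlinarith [mul_le_mul_of_nonneg_right hlow h1q.le]
  · nlinarith [mul_le_mul_of_nonneg_right hup h1q.le]

/-- Quantitative zero-freeness: `‖villainTwisted t ν φ‖·(1 − q) ≥ √(2π/t)·exp(−φ²/(2t))·(1 − 3q)`. -/
theorem villainTwisted_norm_lower {t δ φ q : ℝ} (ht : 0 < t) (hδ : 0 ≤ δ) (hδπ : δ ≤ Real.pi)
    (hφ : |φ| ≤ Real.pi - δ) (hqdef : q = Real.exp (-(2 * Real.pi * δ / t))) (hq1 : q < 1) (ν : ℝ) :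
    Real.sqrt (2 * Real.pi / t) * Real.exp (-φ ^ 2 / (2 * t)) * (1 - 3 * q)
      ≤ ‖villainTwisted t ν φ‖ * (1 - q) := by
  have hlow := (villainTwisted_tsum_norm_bounds ht hδ hδπ hφ hqdef hq1 ν).1
  have hc : 0 ≤ Real.sqrt (2 * Real.pi / t) := Real.sqrt_nonneg _
  unfold villainTwisted
  rw [norm_mul, Complex.norm_real, Real.norm_of_nonneg hc]
  have := mul_le_mul_of_nonneg_left hlow hc
  nlinarith [this]

/-- **K15 / (H2) model case: Gaussian decay in the real twist at every tilt.** For `t > 0`, `0 ≤ δ ≤ π`,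
`|φ| ≤ π − δ`, `q = exp(−2πδ/t) < 1/3` and EVERY real `ν`:
`‖villainTwisted t ν φ‖·(1 − 3q) ≤ exp(−φ²/(2t))·(1 + q)·‖villainTwisted t ν 0‖`. -/
theorem villainTwisted_norm_gaussian_decay {t δ φ q : ℝ} (ht : 0 < t) (hδ : 0 ≤ δ) (hδπ : δ ≤ Real.pi)
    (hφ : |φ| ≤ Real.pi - δ) (hqdef : q = Real.exp (-(2 * Real.pi * δ / t))) (hq3 : q < 1 / 3) (ν : ℝ) :
    ‖villainTwisted t ν φ‖ * (1 - 3 * q)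
      ≤ Real.exp (-φ ^ 2 / (2 * t)) * (1 + q) * ‖villainTwisted t ν 0‖ := by
  have hq0 : 0 ≤ q := by rw [hqdef]; exact (Real.exp_pos _).le
  have hq1 : q < 1 := by linarith
  have h1q : 0 < 1 - q := by linarith
  have h3q : 0 < 1 - 3 * q := by linarith
  have hφ0 : |(0 : ℝ)| ≤ Real.pi - δ := by rw [abs_zero]; linarith
  -- upper bound at φ, lower bound at 0
  have hup := (villainTwisted_tsum_norm_bounds ht hδ hδπ hφ hqdef hq1 ν).2
  have hlow := (villainTwisted_tsum_norm_bounds ht hδ hδπ hφ0 hqdef hq1 ν).1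
  have h0 : Real.exp (-(0 : ℝ) ^ 2 / (2 * t)) = 1 := by simp
  rw [h0, one_mul] at hlow
  set A : ℝ := Real.exp (-φ ^ 2 / (2 * t)) with hA
  have hA0 : 0 < A := Real.exp_pos _
  set SF : ℝ := ‖∑' k : ℤ, villainTwistedTerm t ν φ k‖ with hSF
  set S0 : ℝ := ‖∑' k : ℤ, villainTwistedTerm t ν 0 k‖ with hS0
  have hSF0 : 0 ≤ SF := norm_nonneg _
  have hS00 : 0 ≤ S0 := norm_nonneg _
  -- SF (1-3q)(1-q) ≤ A(1+q)(1-3q) ≤ A(1+q) S0 (1-q), then cancel (1-q)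
  have hkey : SF * (1 - 3 * q) * (1 - q) ≤ A * (1 + q) * S0 * (1 - q) := by
    have e1 : SF * (1 - 3 * q) * (1 - q) = (SF * (1 - q)) * (1 - 3 * q) := by ring
    have e2 : A * (1 + q) * S0 * (1 - q) = (A * (1 + q)) * (S0 * (1 - q)) := by ring
    rw [e1, e2]
    have hA1 : 0 ≤ A * (1 + q) := by positivity
    calc SF * (1 - q) * (1 - 3 * q) ≤ A * (1 + q) * (1 - 3 * q) :=
          mul_le_mul_of_nonneg_right hup h3q.le
      _ ≤ A * (1 + q) * (S0 * (1 - q)) := mul_le_mul_of_nonneg_left hlow hA1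
  have hSF' : SF * (1 - 3 * q) ≤ A * (1 + q) * S0 := le_of_mul_le_mul_right hkey h1q
  -- restore the common prefactor √(2π/t)
  have hc : 0 ≤ Real.sqrt (2 * Real.pi / t) := Real.sqrt_nonneg _
  unfold villainTwisted
  rw [norm_mul, norm_mul, Complex.norm_real, Real.norm_of_nonneg hc]
  have := mul_le_mul_of_nonneg_left hSF' hc
  nlinarith [this]

/-- The same for the rotor temporal transfer weight `Σ_n exp(inφ − t(n−ν)²/2)` (K12): for every filling
`ν`, `‖rotorWeight t ν φ‖·(1 − 3q) ≤ exp(−φ²/(2t))·(1 + q)·‖rotorWeight t ν 0‖` on `|φ| ≤ π − δ`,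
`q = exp(−2πδ/t) < 1/3`. In the dictionary of the interpolation lemma (`t = 1/β`, tilt `ψ = −tν`):
`|Ẑ(φ + iψ)| ≤ (1+q)/(1−3q)·e^{−βφ²/2}·Ẑ(iψ)` — hypothesis (H2) / clause (Z_far), uniformly in the tilt. -/
theorem rotorWeight_norm_gaussian_decay {t δ φ q : ℝ} (ht : 0 < t) (hδ : 0 ≤ δ) (hδπ : δ ≤ Real.pi)
    (hφ : |φ| ≤ Real.pi - δ) (hqdef : q = Real.exp (-(2 * Real.pi * δ / t))) (hq3 : q < 1 / 3) (ν : ℝ) :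
    ‖rotorWeight t ν φ‖ * (1 - 3 * q)
      ≤ Real.exp (-φ ^ 2 / (2 * t)) * (1 + q) * ‖rotorWeight t ν 0‖ := by
  rw [rotorWeight_eq_villainTwisted t ν φ ht, rotorWeight_eq_villainTwisted t ν 0 ht]
  exact villainTwisted_norm_gaussian_decay ht hδ hδπ hφ hqdef hq3 ν

end Summit.AtomisticToContinuum.BoseEinsteinCondensation.Theorems
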